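import Summits.ABC.IUTFork.Joshi.ATS2TestInterface
import Summits.ABC.IUTFork.Joshi.LogLinkColumn
import Summits.ABC.IUTFork.Joshi.PrimitiveAnsatz
import HarnessLib

/-!
# Joshi [J-II] §11 / [J-IIp] §10 log-links vs OUR (Ind3), TEST: the log-Kummer shift RESCALES (Thm. 10.20.1 (3)), the typed (Ind3) is
# region-invisible under Thm. 3.11 (ii)(b) — so dictionary row D-07 cannot be a size-faithful REGION binding

Record file of the abc-iut cell, branch E (rung LADDER-ABC:A2.E; seat abc-iut-E-t2 — the (Ind3) row of this seat's brief «map the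
log-link / comparison objects of [J-II] to the (Ind1)(Ind2)(Ind3)-typed interface»; a `Joshi/Test*` file, E-PLAN R14: OUR side imported BY
NAME through `Joshi/ATS2TestInterface`). TAKES NO SIDE on [IUTchIII] Cor. 3.12, on Joshi's claims (arXiv:2111.04890 [J-II] §11 Thm.
`th:log-link` / Cor. `cor:log-link-in-arithmetic`, chunk p0016 l. 50–59; arXiv:2303.01662v3 [J-IIp] §10, Thm. 10.20.1, Rmk. 10.20.3–10.20.5, pp.
35–37; unrefereed, bibs `Joshi2021ATS2` / `Joshi2023ATS2Local`) or on Mochizuki's report on them; typed ≠ proved ≠ endorsed.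

THE TWO TYPED FACTS, SIDE BY SIDE (both kernel; neither adjudicates the other):
* JOSHI SIDE (abc-iut-E-t3's `Joshi/LogLinkColumn`, DERIVED from [FF18, Prop. 2.2.17]): along the Frobenius column `y_n = φⁿ(y_a)` of an
  Ansatz point — consecutive members being log-linked ([J-IIp] Thm. 10.9.1 / Cor. 10.19.1 = [J-II] Thm. 11.1 / Cor. 11.2) — the valuation
  of `p` GROWS: `scale(y_n) = pⁿ·scale(y_a)` (`PeriodRingDatum.scale_column_pt`, Thm. 10.20.1 (3) «`|p|_{K_{y_{n−1}}} = |p|_{K_{y_n}}^{1/p}`»,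
  (5) «the valuations of `p`, and hence of the Tate parameters … grow along the fiber»); so the Teichmüller lifts of the theta value `ξ`
  at `y_0, y_1, …` have pairwise DISTINCT sizes (`ColumnLifts.norm_teich_x`, `norm_teich_x_injective`).
* OUR SIDE ([IUTchIII] Thm. 3.11 (ii) as typed by abc-iut-c312-1, `Thm311.Column`): (Ind3) is the variation of the Kummer isomorphisms
  in the column index `m`, and (ii)(b) `KummerB` («isomorphisms of splitting monoids … for every `m`»; mutual compatibility p. 156: «the
  only portions … possibly related to one another via the log-links consist of roots of unity») makes the Kummer image `frobΨ m` of the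
  Θ-splitting monoid THE SAME for every `m`: the (Ind3)-family of Θ-regions `ρ (frobΨ m)` is CONSTANT (`frobΨ_region_eq`).
CONSEQUENCE (`not_columnSide_of_sizeInjective`): dictionary row D-07 («log-link / log-Kummer shift (Joshi's Ind3) ↦ `Thm311.Column`,
`frobΨ m`», E-PLAN §3) CANNOT be read as a size-faithful REGION binding — «the `ρ`-region of the column-`(m₀+n)` Kummer image is the region
of the lift of `ξ` at the `n`-th log-link step» (`ColumnSide`) together with a binding `reg` injective on sizes contradicts `KummerB`:
OUR typed (Ind3) carries no valuation growth, Joshi's log-Kummer shift does ([J-IIp] Rmk. 10.20.3 (2) «log-Kummer indeterminacy»). This is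
the (Ind3)-analogue of E-cx's X-06 (`JInd2InIsm` vs rescaling) and of this seat's `QSide` location; it LOCATES where the two constructions'
"Ind3" differ, nothing more. Satisfiable side: with `reg` constant (size-blind) `ColumnSide` holds trivially (`columnSide_of_const`) — the
obstruction is exactly size-faithfulness. [claim: Joshi2023ATS2Local, status: disputed] [claim: Joshi2021ATS2, status: disputed]
[claim: Mochizuki2012, status: disputed]
-/

noncomputable section

open Set

namespace Summit.ABC.IUTFork.Joshi.ATS2

open Thm311 Cor312 Cor312Vol

variable {F B E0 : Type} [Field F] [CommRing B] [Field E0] {Y : Type} {K : Y → Type} [∀ y, Field (K y)] {G : Type}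

/-! ## 1. Joshi side: lifts of the theta value along the Frobenius column have strictly growing sizes -/

/-- **Teichmüller lifts of `ξ` along the Frobenius column** `y_n = φⁿ(y_a)` of an Ansatz point ([J-IIp] §10.13 p. 33 l. 1–10, Thm.
10.20.1; [J-II] §11): an Ansatz parameter `a` and, for every `n`, a lift `x_n` with `η_{K_{y_n}}([x_n]) = ι(ξ)` (they exist:
`ColumnLifts.exists_of_mem`, E-t3's `exists_lift_xi`). DATA over abc-iut-E-t3's `PrototypeDatum`. [claim: Joshi2023ATS2Local, status: disputed] -/
structure ColumnLifts (Pd : PrototypeDatum F B E0 Y K G) where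
  /-- the Ansatz parameter `a ∈ 𝔪_F ∖ {0}` -/
  a : F
  /-- membership -/
  a_mem : a ∈ Pd.AnsatzParam
  /-- the representatives `x_n` -/
  x : ℕ → F
  /-- `η_{K_{φⁿ(y_a)}}([x_n]) = ι(ξ)` -/
  lifts : ∀ n, Pd.eta (Pd.column (Pd.pt a) n) (Pd.teich (x n)) = Pd.emb _ Pd.xi

namespace ColumnLifts

variable {Pd : PrototypeDatum F B E0 Y K G}

/-- Column lifts exist along the column of every Ansatz parameter. [folklore] -/
theorem exists_of_mem {a : F} (ha : a ∈ Pd.AnsatzParam) : ∃ C : ColumnLifts Pd, C.a = a := by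
  choose x hx using fun n => Pd.exists_lift_xi (Pd.column (Pd.pt a) n)
  exact ⟨⟨a, ha, x, hx⟩, rfl⟩

variable (C : ColumnLifts Pd)

/-- **The size of the `n`-th column lift**: `|[x_n]|_ρ = |ξ|_0^{pⁿ·s}`, `s = scale(y_a)` ([J-IIp] Thm. 10.20.1 (3)(5) via E-t3's
`norm_teich_lift` + `scale_column_pt`). DERIVED. [claim: Joshi2023ATS2Local, status: disputed] -/
theorem norm_teich_x {ρ : ℝ} (hρ : 0 < ρ) (hρ1 : ρ ≤ 1) (n : ℕ) :
    Pd.norm ρ (Pd.teich (C.x n)) = Pd.abs0 Pd.xi ^ (((Pd.p ^ n : ℕ) : ℝ) * Pd.scale (Pd.pt C.a)) := by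
  rw [Pd.norm_teich_lift hρ hρ1 (C.lifts n), Pd.scale_column_pt C.a_mem.1 C.a_mem.2 n]

/-- **The sizes along the column are pairwise distinct** (`p ≥ 2`, `s > 0`, `0 < |ξ|_0 < 1`): the log-Kummer shift RESCALES.
DERIVED. [claim: Joshi2023ATS2Local, status: disputed] -/
theorem norm_teich_x_injective {ρ : ℝ} (hρ : 0 < ρ) (hρ1 : ρ ≤ 1) {n n' : ℕ}
    (h : Pd.norm ρ (Pd.teich (C.x n)) = Pd.norm ρ (Pd.teich (C.x n'))) : n = n' := by
  rw [C.norm_teich_x hρ hρ1, C.norm_teich_x hρ hρ1] at h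
  have hs := Pd.scale_pos (Pd.pt C.a)
  have hexp : ((Pd.p ^ n : ℕ) : ℝ) * Pd.scale (Pd.pt C.a) = ((Pd.p ^ n' : ℕ) : ℝ) * Pd.scale (Pd.pt C.a) :=
    le_antisymm
      ((Real.rpow_le_rpow_left_iff_of_base_lt_one Pd.abs0_xi_pos Pd.abs0_xi_lt_one).1 h.symm.le)
      ((Real.rpow_le_rpow_left_iff_of_base_lt_one Pd.abs0_xi_pos Pd.abs0_xi_lt_one).1 h.le)
  have hpow : ((Pd.p ^ n : ℕ) : ℝ) = ((Pd.p ^ n' : ℕ) : ℝ) := mul_right_cancel₀ hs.ne' hexp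
  have hnat : Pd.p ^ n = Pd.p ^ n' := by exact_mod_cast hpow
  exact Nat.pow_right_injective Pd.p_prime.two_le hnat

/-- In particular the lifts at `y_a` and at `φ(y_a)` have different sizes. [folklore] -/
theorem norm_teich_x_zero_ne_one {ρ : ℝ} (hρ : 0 < ρ) (hρ1 : ρ ≤ 1) :
    Pd.norm ρ (Pd.teich (C.x 0)) ≠ Pd.norm ρ (Pd.teich (C.x 1)) := fun h =>
  absurd (C.norm_teich_x_injective hρ hρ1 h) Nat.zero_ne_one

end ColumnLifts

/-! ## 2. Our side: under Thm. 3.11 (ii)(b) the (Ind3)-family of Θ-regions is constant -/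

variable {T : ThetaIndex} (S : LatticeSituation T) (P : Cor312.Setting S.toSituation)
  (ρ : (∀ v : T.V, v ∈ T.Vbad → Set (S.L.StarPacket v)) → ∀ (j : T.Label) (vQ : T.VQ), Set (S.L.Packet j vQ))

/-- **OUR (Ind3) is region-invisible under (ii)(b)**: `KummerB` («for every `m` the Kummer image of the Frobenius-like splitting monoid
IS the vertically coric one», abc-iut-c312-1's `Thm311.Column.KummerB`) makes the `ρ`-region of the column-`m` Kummer image independent
of `m`. Kernel bookkeeping. [claim: Mochizuki2012, status: disputed] -/
theorem frobΨ_region_eq (hKumB : (S.col P.n).KummerB (S.D P.n)) (m m' : ℤ) (j : T.Label) (vQ : T.VQ) :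
    ρ ((S.col P.n).frobΨ m) j vQ = ρ ((S.col P.n).frobΨ m') j vQ := by
  have h : ∀ k : ℤ, (S.col P.n).frobΨ k = (S.D P.n).Ψ := fun k => funext fun v => funext fun hv => hKumB k v hv
  rw [h m, h m']

/-! ## 3. The D-07 region binding and its obstruction -/

/-- **`ColumnSide` — dictionary row D-07 read as a REGION binding** (E-PLAN §3 D-07 «log-link / log-Kummer shift (Joshi Ind3) ↦
`Thm311.Column`, `frobΨ m`, upper semi-compatibility»): for a binding `reg` of Joshi's container to our packets and a base column
position `m₀`, the `ρ`-region of the column-`(m₀ + n)` Kummer image of the Θ-splitting monoid is the region of the lift of `ξ` at the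
`n`-th log-link step `φⁿ(y_a)`. CANDIDATE dictionary clause (OUR READING of the correspondence), named, never asserted.
[claim: Joshi2023ATS2Local, status: disputed] [claim: Mochizuki2012, status: disputed] -/
@[claim "Joshi2023ATS2Local" "disputed"]
def ColumnSide {Pd : PrototypeDatum F B E0 Y K G} (C : ColumnLifts Pd)
    (reg : ∀ (j : T.Label) (vQ : T.VQ), B → Set (S.L.Packet j vQ)) (m₀ : ℤ) : Prop :=
  ∀ (n : ℕ) (j : T.Label) (vQ : T.VQ), ρ ((S.col P.n).frobΨ (m₀ + n)) j vQ = reg j vQ (Pd.teich (C.x n))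

/-- With a size-BLIND (constant) binding, `ColumnSide` holds as soon as the constant is the Θ-region — the clause is satisfiable;
the obstruction below is exactly size-faithfulness. [folklore] -/
theorem columnSide_of_const {Pd : PrototypeDatum F B E0 Y K G} (C : ColumnLifts Pd) (hKumB : (S.col P.n).KummerB (S.D P.n))
    (m₀ : ℤ) : ColumnSide S P ρ C (fun j vQ _ => ρ (S.D P.n).Ψ j vQ) m₀ := fun n j vQ => by
  have h : (S.col P.n).frobΨ (m₀ + n) = (S.D P.n).Ψ := funext fun v => funext fun hv => hKumB _ v hv
  rw [h]

/-- **The obstruction**: under Thm. 3.11 (ii)(b) `KummerB`, NO binding `reg` that is injective on sizes (`reg b = reg b′ ⇒ |b|_{ρ₀} =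
|b′|_{ρ₀}` — every ball-reading) satisfies `ColumnSide`: our column-`m` regions coincide for all `m` (`frobΨ_region_eq`) while Joshi's
column lifts at `y_a` and `φ(y_a)` have different sizes (`norm_teich_x_zero_ne_one`, Thm. 10.20.1 (3)). So D-07 cannot transport the
valuation growth of Joshi's log-Kummer shift into OUR (Ind3). Located, not adjudicated. [claim: Joshi2023ATS2Local, status: disputed]
[claim: Mochizuki2012, status: disputed] -/
theorem not_columnSide_of_sizeInjective {Pd : PrototypeDatum F B E0 Y K G} (C : ColumnLifts Pd)
    (hKumB : (S.col P.n).KummerB (S.D P.n)) {ρ₀ : ℝ} (hρ : 0 < ρ₀) (hρ1 : ρ₀ ≤ 1)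
    (reg : ∀ (j : T.Label) (vQ : T.VQ), B → Set (S.L.Packet j vQ))
    (hinj : ∀ (j : T.Label) (vQ : T.VQ) (b b' : B), reg j vQ b = reg j vQ b' → Pd.norm ρ₀ b = Pd.norm ρ₀ b') (m₀ : ℤ) :
    ¬ ColumnSide S P ρ C reg m₀ := by
  intro h
  obtain ⟨v, _⟩ := T.Vbad_nonempty
  have h0 := h 0 0 (T.over v)
  have h1 := h 1 0 (T.over v)
  have hreg : reg 0 (T.over v) (Pd.teich (C.x 0)) = reg 0 (T.over v) (Pd.teich (C.x 1)) := by
    rw [← h0, ← h1]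
    exact frobΨ_region_eq S P ρ hKumB _ _ 0 (T.over v)
  exact C.norm_teich_x_zero_ne_one hρ hρ1 (hinj _ _ _ _ hreg)

/-- Over the typed Theorem 3.11 (`FullSituation.Statement` supplies `KummerB`): no size-injective D-07 region binding.
[claim: Mochizuki2012, status: disputed] -/
theorem not_columnSide_of_thm311 {F' : FullSituation T} (P : Cor312.Setting F'.toLatticeSituation.toSituation)
    (ρ : (∀ v : T.V, v ∈ T.Vbad → Set (F'.L.StarPacket v)) → ∀ (j : T.Label) (vQ : T.VQ), Set (F'.L.Packet j vQ))
    (hThm : F'.Statement) {Pd : PrototypeDatum F B E0 Y K G} (C : ColumnLifts Pd) {ρ₀ : ℝ} (hρ : 0 < ρ₀) (hρ1 : ρ₀ ≤ 1)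
    (reg : ∀ (j : T.Label) (vQ : T.VQ), B → Set (F'.L.Packet j vQ))
    (hinj : ∀ (j : T.Label) (vQ : T.VQ) (b b' : B), reg j vQ b = reg j vQ b' → Pd.norm ρ₀ b = Pd.norm ρ₀ b') (m₀ : ℤ) :
    ¬ ColumnSide F'.toLatticeSituation P ρ C reg m₀ :=
  not_columnSide_of_sizeInjective F'.toLatticeSituation P ρ C (GluedMonoids.kummerB_of_statement F' hThm P.n) hρ hρ1 reg hinj m₀

end Summit.ABC.IUTFork.Joshi.ATS2

end
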